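import Literature.Computability.Cryptography.IIDStatisticalDistance
import Literature.Computability.Cryptography.StatisticalDistanceMapProofs
import Literature.Probability.Distributions.IndepProductLaw
import Mathlib.Probability.Distributions.Uniform
import HarnessLib

/-!
# Statistical distance under kernels and independent products; uniform product laws

Topic `Probability/Distributions`; theorems-only companion of `IndepProductLaw.lean`
(`indepLaw K p : PMF (Fin K → α)`, the law of `K` independent, not identically distributed
variables) and of the statistical-distance toolkit `PMF.tvDist`
(`Computability/Cryptography/StatisticalDistance*.lean`, `IIDStatisticalDistance.lean`, which has
the iid hybrid bound `Δ(p^{⊗N}, q^{⊗N}) ≤ N Δ(p, q)` only). Written for the distributional analysis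
of the Micciancio–Regev worst-case/average-case reductions (MR07 Thm. 5.9 eq. (13):
"since the vectors `cᵢ` are independent, `Δ(C, U(P(B)ᵐ)) ≤ ∑ᵢ Δ(cᵢ, U(P(B)))`", followed by "by
Lemma 5.8 … the distribution of the query … is also uniform … by the properties of the statistical
distance, the event `H` holds with probability at least `δ_{j,α} − εm/2`"), but everything here is
generic and folklore:

* `PMF.tvDist_bind_left_le` — **Markov kernels contract statistical distance**:
  `Δ(μ ≫= κ, ν ≫= κ) ≤ Δ(μ, ν)`; event form `PMF.abs_toReal_toOuterMeasure_bind_sub_le_tvDist`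
  (`|Pr_{μ≫=κ}[S] − Pr_{ν≫=κ}[S]| ≤ Δ(μ, ν)`: post-processing by a randomised procedure, e.g. an
  oracle call, moves no event by more than the distance of the inputs);
* `PMF.tvDist_bind_right_right_le` — two kernels, one prior:
  `Δ(μ ≫= f, μ ≫= g) ≤ ∑_ω μ(ω) Δ(f ω, g ω)`, whence `PMF.tvDist_bind_le_of_forall_le` and the
  combined `PMF.tvDist_bind_bind_le` (`Δ(μ ≫= f, ν ≫= g) ≤ Δ(μ, ν) + δ`);
* `tvDist_indepLaw_le` — **the hybrid bound for independent, not identically distributed,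
  coordinates**: `Δ(⨂ⱼ pⱼ, ⨂ⱼ qⱼ) ≤ ∑ⱼ Δ(pⱼ, qⱼ)`;
* `indepLaw_map_pi` — coordinatewise maps: `(⨂ⱼ pⱼ).map (v ↦ (fⱼ vⱼ)ⱼ) = ⨂ⱼ (pⱼ.map fⱼ)`;
* `indepLaw_uniformOfFintype` — `⨂ⱼ U(α) = U(Fin K → α)`; hence `tvDist_indepLaw_uniformOfFintype_le`
  (`Δ(⨂ⱼ pⱼ, U(αᴷ)) ≤ ∑ⱼ Δ(pⱼ, U(α))`) and `map_pi_uniformOfFintype` (coordinatewise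
  uniformity-preserving maps preserve the uniform law on tuples);
* `map_uniformOfFintype_of_card_fiber` — a map with fibres of equal nonzero size pushes `U(α)` to
  `U(β)`.

## References

* O. Goldreich, *Foundations of Cryptography I*, CUP 2001, §3.2.1–§3.2.3 (statistical distance does
  not increase under (randomised) processing; hybrid arguments, proof of Thm 3.2.6) [Goldreich2001].
* D. Micciancio, O. Regev, *Worst-case to average-case reductions based on Gaussian measures*,
  SIAM J. Comput. 37 (2007) 267–302, proof of Thm. 5.9, eq. (13) (the consumer) [MicciancioRegev2007].
-/

noncomputable section

open scoped ENNReal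

/-! ### Kernels -/

namespace PMF

variable {α Ω : Type*}

/-- **Markov kernels contract statistical distance** (data processing for randomised maps):
`Δ(μ ≫= κ, ν ≫= κ) ≤ Δ(μ, ν)`. For every event `S`, `Pr_{μ≫=κ}[S] − Pr_{ν≫=κ}[S] =
E_μ[h] − E_ν[h]` with `h(ω) = κ_ω(S) ∈ [0, 1]`, which is `≤ Δ(μ, ν)`
(`tsum_toReal_mul_sub_le_tvDist`); take the supremum over `S`.
[cite: Goldreich2001, §3.2.1 (Exercise 10 of Ch. 3, randomised version)] -/
theorem tvDist_bind_left_le (μ ν : PMF Ω) (κ : Ω → PMF α) :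
    (μ.bind κ).tvDist (ν.bind κ) ≤ μ.tvDist ν := by
  rw [tvDist_eq_iSup_measure_holds (μ.bind κ)]
  refine ciSup_le fun S => ?_
  rw [toReal_toOuterMeasure_bind_apply, toReal_toOuterMeasure_bind_apply]
  exact tsum_toReal_mul_sub_le_tvDist μ ν (fun ω => ENNReal.toReal_nonneg)
    (fun ω => toReal_toOuterMeasure_le_one _ _)

/-- **Event form of kernel contraction**: `|Pr_{μ≫=κ}[S] − Pr_{ν≫=κ}[S]| ≤ Δ(μ, ν)` for every
event `S` — feeding two `Δ`-close inputs to the same randomised procedure changes the probability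
of any outcome event by at most `Δ`. [cite: Goldreich2001, §3.2.1] -/
theorem abs_toReal_toOuterMeasure_bind_sub_le_tvDist (μ ν : PMF Ω) (κ : Ω → PMF α) (S : Set α) :
    |((μ.bind κ).toOuterMeasure S).toReal - ((ν.bind κ).toOuterMeasure S).toReal| ≤ μ.tvDist ν :=
  (abs_toReal_toOuterMeasure_sub_le_tvDist _ _ S).trans (tvDist_bind_left_le μ ν κ)

/-- **Two kernels under one prior**: `Δ(μ ≫= f, μ ≫= g) ≤ ∑_ω μ(ω) Δ(f ω, g ω)`.
[cite: Goldreich2001, §3.2.2 Eq. (3.1)] -/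
theorem tvDist_bind_right_right_le (μ : PMF Ω) (f g : Ω → PMF α) :
    (μ.bind f).tvDist (μ.bind g) ≤ ∑' ω, (μ ω).toReal * (f ω).tvDist (g ω) := by
  rw [tvDist_eq_iSup_measure_holds]
  refine ciSup_le fun S => ?_
  have hsf : Summable fun ω => (μ ω).toReal * ((f ω).toOuterMeasure S).toReal :=
    summable_toReal_mul_of_abs_le_one μ fun ω => by
      rw [abs_of_nonneg ENNReal.toReal_nonneg]; exact toReal_toOuterMeasure_le_one _ _
  have hsg : Summable fun ω => (μ ω).toReal * ((g ω).toOuterMeasure S).toReal :=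
    summable_toReal_mul_of_abs_le_one μ fun ω => by
      rw [abs_of_nonneg ENNReal.toReal_nonneg]; exact toReal_toOuterMeasure_le_one _ _
  have hs : Summable fun ω => (μ ω).toReal * (f ω).tvDist (g ω) :=
    summable_toReal_mul_of_abs_le_one μ fun ω => by
      rw [abs_of_nonneg (tvDist_nonneg _ _)]; exact tvDist_le_one_holds _ _
  rw [toReal_toOuterMeasure_bind_apply, toReal_toOuterMeasure_bind_apply, ← hsf.tsum_sub hsg]
  refine (hsf.sub hsg).tsum_le_tsum (fun ω => ?_) hs
  rw [← mul_sub]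
  exact mul_le_mul_of_nonneg_left (toReal_toOuterMeasure_sub_le_tvDist _ _ S) ENNReal.toReal_nonneg

/-- If `Δ(f ω, g ω) ≤ δ` for every `ω`, then `Δ(μ ≫= f, μ ≫= g) ≤ δ`. [cite: Goldreich2001, §3.2.2] -/
theorem tvDist_bind_le_of_forall_le (μ : PMF Ω) (f g : Ω → PMF α) {δ : ℝ}
    (h : ∀ ω, (f ω).tvDist (g ω) ≤ δ) : (μ.bind f).tvDist (μ.bind g) ≤ δ := by
  refine (tvDist_bind_right_right_le μ f g).trans ?_
  have hs : Summable fun ω => (μ ω).toReal * (f ω).tvDist (g ω) :=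
    summable_toReal_mul_of_abs_le_one μ fun ω => by
      rw [abs_of_nonneg (tvDist_nonneg _ _)]; exact tvDist_le_one_holds _ _
  calc ∑' ω, (μ ω).toReal * (f ω).tvDist (g ω) ≤ ∑' ω, (μ ω).toReal * δ :=
        hs.tsum_le_tsum (fun ω => mul_le_mul_of_nonneg_left (h ω) ENNReal.toReal_nonneg)
          ((summable_coe_toReal μ).mul_right _)
    _ = δ := by rw [tsum_mul_right, tsum_coe_toReal, one_mul]

/-- **Priors and kernels together**: if `Δ(f ω, g ω) ≤ δ` for every `ω`, then
`Δ(μ ≫= f, ν ≫= g) ≤ Δ(μ, ν) + δ` (triangle inequality through `ν ≫= f`). [cite: Goldreich2001, §3.2.2] -/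
theorem tvDist_bind_bind_le (μ ν : PMF Ω) (f g : Ω → PMF α) {δ : ℝ}
    (h : ∀ ω, (f ω).tvDist (g ω) ≤ δ) : (μ.bind f).tvDist (ν.bind g) ≤ μ.tvDist ν + δ :=
  (tvDist_triangle_holds _ (ν.bind f) _).trans
    (add_le_add (tvDist_bind_left_le μ ν f) (tvDist_bind_le_of_forall_le ν f g h))

end PMF

/-! ### Independent products -/

namespace Literature.Probability.Distributions

open PMF

variable {α β : Type*}

/-- **Hybrid bound for independent coordinates**: `Δ(⨂ⱼ pⱼ, ⨂ⱼ qⱼ) ≤ ∑ⱼ Δ(pⱼ, qⱼ)`. Induction on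
`K` along `indepLaw_succ`: replace the first coordinate (kernel contraction, cost `Δ(p₀, q₀)`), then
the tail inside the kernel `a ↦ cons a (·)` (cost `Δ` of the tails, by `tvDist_bind_le_of_forall_le`
and data processing for `cons a`). [cite: Goldreich2001, §3.2.3 (Thm 3.2.6, proof: hybrid argument)] -/
theorem tvDist_indepLaw_le : ∀ (K : ℕ) (p q : Fin K → PMF α),
    (indepLaw K p).tvDist (indepLaw K q) ≤ ∑ j, (p j).tvDist (q j)
  | 0, p, q => by simp
  | K + 1, p, q => by
    rw [indepLaw_succ, indepLaw_succ, Fin.sum_univ_succ]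
    refine (tvDist_bind_bind_le (p 0) (q 0) _ _ (δ := (indepLaw K fun j => p j.succ).tvDist
      (indepLaw K fun j => q j.succ)) fun a => tvDist_map_le_holds _ _ _).trans ?_
    exact add_le_add le_rfl (tvDist_indepLaw_le K _ _)

/-- **Coordinatewise maps of an independent product**: `(⨂ⱼ pⱼ).map (v ↦ (fⱼ (vⱼ))ⱼ) = ⨂ⱼ (pⱼ.map fⱼ)`
(independence is preserved by processing each coordinate separately). [folklore] -/
theorem indepLaw_map_pi : ∀ (K : ℕ) (p : Fin K → PMF α) (f : Fin K → α → β),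
    (indepLaw K p).map (fun v j => f j (v j)) = indepLaw K fun j => (p j).map (f j)
  | 0, p, f => by
    rw [indepLaw_zero, indepLaw_zero, PMF.pure_map]
    exact congrArg PMF.pure (Subsingleton.elim _ _)
  | K + 1, p, f => by
    rw [indepLaw_succ, indepLaw_succ, PMF.map_bind, PMF.bind_map]
    refine congrArg ((p 0).bind ·) (funext fun a => ?_)
    simp only [Function.comp_def, PMF.map_comp]
    rw [← indepLaw_map_pi K (fun j => p j.succ) (fun j => f j.succ), PMF.map_comp]
    refine congrArg (PMF.map · _) (funext fun v => funext fun j => ?_)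
    refine Fin.cases ?_ (fun i => ?_) j
    · simp
    · simp

/-- **Independent uniform coordinates form a uniform tuple**: `⨂_{j<K} U(α) = U(Fin K → α)`.
[folklore] -/
theorem indepLaw_uniformOfFintype [Fintype α] [Nonempty α] (K : ℕ) :
    indepLaw K (fun _ => PMF.uniformOfFintype α) = PMF.uniformOfFintype (Fin K → α) := by
  classical
  refine (indepLaw_eq_of_apply _ _ fun v => ?_).symm
  simp only [PMF.uniformOfFintype_apply, Finset.prod_const, Finset.card_univ, Fintype.card_fin,
    Fintype.card_pi, Nat.cast_pow]
  rw [ENNReal.inv_pow]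

/-- **Distance of an independent product from the uniform tuple**:
`Δ(⨂ⱼ pⱼ, U(Fin K → α)) ≤ ∑ⱼ Δ(pⱼ, U(α))` — MR07 eq. (13) in abstract form.
[cite: MicciancioRegev2007, proof of Thm. 5.9, eq. (13)] -/
theorem tvDist_indepLaw_uniformOfFintype_le [Fintype α] [Nonempty α] (K : ℕ) (p : Fin K → PMF α) :
    (indepLaw K p).tvDist (PMF.uniformOfFintype (Fin K → α)) ≤
      ∑ j, (p j).tvDist (PMF.uniformOfFintype α) := by
  rw [← indepLaw_uniformOfFintype K]
  exact tvDist_indepLaw_le K p _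

/-- **Coordinatewise uniformity-preserving maps preserve the uniform law on tuples**: if each
`fⱼ` pushes `U(α)` to `U(β)`, then `v ↦ (fⱼ vⱼ)ⱼ` pushes `U(Fin K → α)` to `U(Fin K → β)`. [folklore] -/
theorem map_pi_uniformOfFintype [Fintype α] [Nonempty α] [Fintype β] [Nonempty β] (K : ℕ)
    (f : Fin K → α → β) (hf : ∀ j, (PMF.uniformOfFintype α).map (f j) = PMF.uniformOfFintype β) :
    (PMF.uniformOfFintype (Fin K → α)).map (fun v j => f j (v j)) = PMF.uniformOfFintype (Fin K → β) := by
  rw [← indepLaw_uniformOfFintype K, indepLaw_map_pi, ← indepLaw_uniformOfFintype K]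
  exact congrArg (indepLaw K) (funext hf)

/-- **A map all of whose fibres have the same nonzero size pushes the uniform law to the uniform
law.** [folklore] -/
theorem map_uniformOfFintype_of_card_fiber [Fintype α] [Nonempty α] [Fintype β] [Nonempty β]
    [DecidableEq β] (f : α → β) {k : ℕ} (hk : k ≠ 0)
    (h : ∀ b, (Finset.univ.filter fun a => f a = b).card = k) :
    (PMF.uniformOfFintype α).map f = PMF.uniformOfFintype β := by
  classical
  have hcard : Fintype.card α = k * Fintype.card β := by
    rw [← Finset.card_univ, ← Finset.card_univ, Finset.card_eq_sum_card_fiberwise (f := f)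
      (t := Finset.univ) (fun _ _ => Finset.mem_univ _)]
    simp [h, mul_comm]
  ext b
  rw [← PMF.toOuterMeasure_apply_singleton ((PMF.uniformOfFintype α).map f),
    PMF.toOuterMeasure_map_apply, PMF.toOuterMeasure_uniformOfFintype_apply,
    PMF.uniformOfFintype_apply, hcard]
  have hset : (f ⁻¹' {b} : Set α) = ↑(Finset.univ.filter fun a => f a = b) := by ext a; simp
  have hfib : Fintype.card (f ⁻¹' {b} : Set α) = k := by
    rw [← h b, ← Fintype.card_coe (Finset.univ.filter fun a => f a = b)]
    exact Fintype.card_congr' (by rw [hset]; rfl)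
  rw [hfib, Nat.cast_mul]
  have hk' : (k : ℝ≥0∞) ≠ 0 := by exact_mod_cast hk
  rw [ENNReal.div_eq_inv_mul, ENNReal.mul_inv (Or.inl hk') (Or.inl (ENNReal.natCast_ne_top k)),
    mul_comm (k : ℝ≥0∞)⁻¹, mul_assoc, ENNReal.inv_mul_cancel hk' (ENNReal.natCast_ne_top k), mul_one]

end Literature.Probability.Distributions

end
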